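import Literature.MathematicalPhysics.QuantumFieldTheory.Balaban1983to89.B1Ineq358TreeLength
import Literature.Probability.LatticeModels.UrsellConnectedDiagrams
import Literature.MathematicalPhysics.QuantumFieldTheory.Balaban1983to89.B3GaussianPerturbationGraphs

/-!
# `Balaban1983to89.B1Eq323ConnectedGraphBound` — T. Bałaban, *(Higgs)₂,₃ quantum fields in a finite volume. I. A lower bound*,
Commun. Math. Phys. **85** (1982) 603–626 [Balaban1982Higgs1], p. 616 [PDF 14], the sentence after (3.23):
**«⟨Vⁿ⟩^T is the expression corresponding to the sum of connected graphs with exponentially decaying propagators. Hence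
⟨Vⁿ⟩^T = O(ε^κ)|T₁| with κ > d for n sufficiently large, e.g. n > 6»** — THE VOLUME BOUND FOR CONNECTED-GRAPH SUMS, with every
constant explicit and independent of the torus, and — plugged into p33's Gaussian perturbation engine — the bound
`|⟨X_1;…;X_n⟩^T| ≦ O(1)·A₀ⁿ·|T^{(k)}|` for the truncated expectation of `n` polynomial clusters of the shape (3.57) under a centred Gaussian
(theorems + constants with bodies; no `Prop` fact)

statement-level skeleton of published theorems with citation tags; proofs where landed; nothing here is a claim about the Yang–Mills mass gap

PDF held: `paper:balaban1982-cmp85-higgs23-i` (journal page = PDF page + 602); p. 616 [PDF 14] read on the OCR text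
`~/.lit/texts/paper-balaban1982-cmp85-higgs23-i/p0014.txt` and the ×2 render
`run/shared/lean/pub/pub-balaban/b2b-balaban-ref1/pages/1982-cmp85-higgs23-I/1982-cmp85-higgs23-I-p014-x2.png`; p. 622 [PDF 20] ((3.57)/(3.58)).

CITATION HEADER (lean-in-tree rule).  Cell `lit-balaban` (HOME `run/shared/lean/pub/lit-balaban/`), reader/typer seat **r14** (B1 fold owner),
gen 26, free-target protocol G.5-34 (d) (TAKING HOME/STATUS.md 2026-08-25T08:01Z), ZERO head weight: an OPTIONAL LOCATED MEMBER of the rows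
**B1.Eq3.23** / **B1.Eq3.24** (owner r12, `HOME/lit-balaban-r12/ROWS-B1-part2.md`) and **B1.Eq3.59** (owner r14, `HOME/lit-balaban-r14/ROWS-B1.md`;
class D, head unchanged).  USED BY NAME, nothing re-declared: p13's combinatorics of record `Literature.Probability.LatticeModels.LegDiagram`
(`legs`, `diags`, `IsDiag`, `Sep`, `IsConn` — *"if the clusters were considered as points then G would be connected"*), p19's `B3Ineq213.Connects`,
the typer's `B1Ineq358TreeLength.le_sum_of_connects` (a connecting edge set is at least as long as any pairwise distance) and
`B2Ineq2116TreeDecayRegion.diam_le_of_forall`, p14's `B1Ineq358TreeDecaySum.{diam, tdist_le_diam, treeConst, sum_exp_neg_diam_le_treeConst}`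
(`Σ_{z : Fin q → T^{(k)}} e^{−δ·diam z} ≦ |T^{(k)}|·treeConst_q`, the one-point torus sum `B4Sect5Proof.latticeConst`), r14's distance lemmas
`B1Ineq234LevelZero.{tdist_comm, tdist_triangle_real}` / `B1Ineq234Concrete.tdist_self` ((1.3)).  The monomial index `Col P k qmax Lbl` below is
the typer's `B1Eq357FluctuationPolynomial.Idx P N k qmax` at `Lbl = B1Prop32InteractionBound.Leg N P.d` (same Σ-type, definitionally), and the sum
bounded in §5 is the right member of p33's engine `B3GaussianPerturbationGraphs.ursellOf_jmoment_univ` at `J = Fin n`, `K j = univ`,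
`deg c = c.1` (clusters = `n` copies of the polynomial `V`, lines = the pair weights); §6 imports that engine (`jmoment`, `clusterVar`, `pairW`,
`legVec`, `ursellOf_jmoment_univ`, `pairW_pair`, `pairW_of_card_ne_two`, `gexp_two_legs`; p13's `BIJ88TruncationConnected306.gexp` = the
normalized centred Gaussian expectation `⟨G⟩ = ∫G e^{−½⟨Φ,AΦ⟩}dΦ/∫e^{−½⟨Φ,AΦ⟩}dΦ`, `LatticeModels.ursellOf` = Ruelle's truncation) and
§§1–5 use no measure.

THE PRINT (p. 616, verbatim from the OCR, checked on the render).  *"To calculate the integral in the square bracket [...] we use the cumulant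
expansion formula of the form ⟨exp V⟩ = exp[⟨V⟩ + (1/2!)⟨V²⟩^T + (1/3!)⟨V³⟩^T + …], (3.23) where ⟨·⟩ denotes the expectation value with respect to
the measure dμ_{C^{(0)}}(A′)dμ_{C^{(0)}(B^{(1)})}(φ′), V = V^{(0)} and ⟨Vⁿ⟩^T denotes the truncated expectation of a product of n polynomials V …
The coefficients of the polynomial V are proportional to some positive powers of ε. The smallest such power is ε^{1/2} and ⟨Vⁿ⟩^T is the
expression corresponding to the sum of connected graphs with exponentially decaying propagators. Hence ⟨Vⁿ⟩^T = O(ε^κ)|T₁| with κ > d for n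
sufficiently large, e.g. n > 6."*  P. 622, Prop. 3.2: the polynomial has the form (3.57) `Σ_{q} Σ_{z} Σ_{κ} v(q;z;κ)·Π legs` with
`|v^{(k)}(…; x₁,…,y_m)| ≦ O(1)(L^kε)^{κ₀}exp(−δ₀d(x₁,…,y_m))` (3.58).

THE MATHEMATICS MADE A THEOREM HERE (the analytic half of the sentence: CONNECTED ⇒ summable per unit volume).  Fix `n` clusters
(the `n` factors `V` of `⟨Vⁿ⟩^T`).  A COLOURING `z : Fin n → Col` picks for every cluster one monomial of (3.57): a degree `q_j ≦ qmax`, points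
`z_j : Fin q_j → T^{(k)}` and leg labels; the legs of the colouring are the pairs `(j, i)`, `i < q_j`, the leg `(j,i)` sitting at the point
`z_j(i)`.  A DIAGRAM on the clusters (p13's `LegDiagram.diags`, no observable) is a set partition of the legs into blocks; its value is the product
of the block weights `w_z(B)` — for Wick pairings `w_z{l,l′}` = the propagator joining the two legs and `w_z(B) = 0` on blocks that are not pairs
— and the graph is CONNECTED (`LegDiagram.IsConn`) when no proper subfamily of clusters is closed under the blocks.  HYPOTHESES (the print's):
(3.58) in the diameter currency `|a_j(q;z;κ)| ≦ A₀e^{−δ₀·diam z}` (weaker than printed, `d ≧ diam`, `B1Ineq358TreeLength.diam_le_treeLen`), and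
*"exponentially decaying propagators"* `|w_z{l,l′}| ≦ c₀e^{−δ₁|x_l − x_{l′}|}` (distance (1.3) in lattice units of `T^{(k)}`; Prop. 2.3
(2.34)–(2.35) supplies it for the covariances of (3.56)).  CONCLUSION (§5 `abs_connectedSum_le`):
  `|Σ_{z : Fin n → Col} (Π_j a_j(z_j)) · Σ_{g connected diagram} Π_{B∈g} w_z(B)| ≦ connConst(d, |Lbl|, n, qmax, c₀, δ₀, δ₁) · A₀ⁿ · |T^{(k)}|`,
`connConst` (§5) explicit and independent of the torus, of `k` and of `ε`; with `A₀ = O(1)(L^kε)^{κ₀}` this is `O(1)(L^kε)^{nκ₀}|T₁^{(k)}|`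
(`abs_connectedSum_le_scale`) — the print's *"O(ε^κ)|T₁| with κ > d for n sufficiently large"* (`κ = nκ₀`).  §6 (`abs_ursellOf_jmoment_le`,
`abs_ursellOf_jmoment_le_scale`): in p13's presentation of a centred Gaussian (`gexp A 0`, `A` positive definite) let the `n` clusters be the
polynomials `X_j = Σ_{c∈Col} a_j(c)·Π_{i<q_c}⟨Φ, v_{c,i}⟩` (the leg `(c,i)` = the linear functional `v_{c,i}`, sitting at `z_c(i)`); p33's engine
says their joint truncated expectation `⟨X_1;…;X_n⟩^T` (`ursellOf` of `Q ↦ ⟨Π_{j∈Q}X_j⟩`; for equal clusters print's `⟨Vⁿ⟩^T`) IS the §5 sum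
with the Wick pair weights `⟨A⁻¹v_l, v_{l′}⟩ = ⟨⟨Φ,v_l⟩⟨Φ,v_{l′}⟩⟩`, so *"exponentially decaying propagators"*
`|⟨⟨Φ,v_{c,i}⟩⟨Φ,v_{c′,i′}⟩⟩| ≦ c₀e^{−δ₁|z_c(i)−z_{c′}(i′)|}` and (3.58) give **`|⟨X_1;…;X_n⟩^T| ≦ connConst·A₀ⁿ·|T^{(k)}|`**
(`≦ connConst·C₀ⁿ·(L^kε)^{nκ₀}·|T^{(k)}|` in the scale form).
MECHANISM (§2–§3).  Connectedness of the diagram ⇒ the blocks together with the intra-cluster pairs CONNECT all the legs (`connects_of_isConn`)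
⇒ by `le_sum_of_connects` every pairwise distance of leg positions, hence the diameter `D` of ALL the points of the colouring, is
`≦ Q·Σ_j q_j·diam z_j + Σ_B blockLen(B)` (`Q` = number of legs, `blockLen{l,l′} = 2|x_l − x_{l′}|`) ⇒ the product of ALL the decay factors is
`≦ e^{−δ′D}`, `δ′ = min(δ₁/2, δ₀/(n·qmax²+1))` ⇒ one tree-decay summation over the concatenated point tuple (`sum_exp_neg_diam_le_treeConst`).
The number of diagrams and of label patterns enters only the constant.

HONEST SCOPE.  (i) §6 holds for p13's finite-dimensional centred Gaussian `gexp A 0`; that the law `dμ_{C^{(k)}}(A′)dμ_{C^{(k)}(B^{(k+1)})}(φ′)`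
of (3.56) (the typer's `B1Eq357FluctuationPolynomial.law356 = fluctMeasure ⊗ condGauss`, both already Lebesgue-density Gaussians) is of this
form with a block-diagonal precision matrix, and that its legs `legVal` are such linear functionals, is a transport NOT done here (successor
member); the propagator decay is a HYPOTHESIS (for (3.56): Prop. 2.3 (2.34)–(2.35)).  (ii) The constant is crude (all diagrams are counted,
`2^Q·2^{2^Q}`; print: "O(1)").
(iii) No claim about the χ-weighted cumulants of (3.24)/(3.59) (their remainder is the lemma of Benfatto et al. [2] p. 152, NOT HELD,
`HOME/MISSING-SOURCES.md`); rows B1.Eq3.24 / B1.Eq3.59 keep their heads.  (iv) Zero `sorry`, no new `Prop` fact; axioms standard.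
-/

noncomputable section

open Finset
open scoped BigOperators

namespace Literature.MathematicalPhysics.QuantumFieldTheory.Balaban1983to89.B1Eq323ConnectedGraphBound

open Literature.Probability.LatticeModels (IsSetPartition setPartitions mem_setPartitions)
open Literature.Probability.LatticeModels.LegDiagram (legs mem_legs diags mem_diags IsDiag Sep IsConn)
open B3Ineq213 (Connects)
open B1Ineq358TreeDecaySum (diam tdist_le_diam treeConst treeConst_nonneg sum_exp_neg_diam_le_treeConst)
open B1Ineq358TreeLength (le_sum_of_connects)
open B2Ineq2116TreeDecayRegion (diam_le_of_forall)
open B1Ineq234LevelZero (tdist_comm tdist_triangle_real)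
open B1Ineq234Concrete (tdist_self)

/-! ## §1 Connected diagrams connect the legs -/

section Connect

variable {J : Type} [Fintype J] [DecidableEq J] {Λ : Type} [Fintype Λ] [DecidableEq Λ] (own : Λ → J)

/-- The vertex family with EVERY cluster present and no observable (p13's indexing by `Option J`). [cite: Balaban1982Higgs1, (3.23) p.616] -/
def allV (J : Type) [Fintype J] : Finset (Option J) := (univ : Finset J).map Function.Embedding.some

omit [DecidableEq J] in
/-- [cite: Balaban1982Higgs1, (3.23) p.616] -/
@[simp] theorem some_mem_allV (j : J) : some j ∈ allV J := mem_map_of_mem _ (mem_univ j)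

omit [DecidableEq J] in
/-- [cite: Balaban1982Higgs1, (3.23) p.616] -/
@[simp] theorem none_not_mem_allV : none ∉ allV J := by simp [allV]

/-- The edge set generated by a diagram: two legs are joined when they belong to the same cluster or to a common block
(*"if the clusters were considered as points"*). [cite: Balaban1982Higgs1, (3.23) p.616] -/
def edgeSet (g : Finset Λ × Finset (Finset Λ)) : Finset (Λ × Λ) :=
  univ.filter fun p => own p.1 = own p.2 ∨ ∃ B ∈ g.2, p.1 ∈ B ∧ p.2 ∈ B

omit [Fintype J] in
/-- [cite: Balaban1982Higgs1, (3.23) p.616] -/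
theorem mem_edgeSet {g : Finset Λ × Finset (Finset Λ)} {p : Λ × Λ} :
    p ∈ edgeSet own g ↔ own p.1 = own p.2 ∨ ∃ B ∈ g.2, p.1 ∈ B ∧ p.2 ∈ B := by
  simp [edgeSet]

/-- A diagram on all the clusters has no observable legs. [cite: Balaban1982Higgs1, (3.23) p.616] -/
theorem fst_eq_empty_of_mem_diags {g : Finset Λ × Finset (Finset Λ)} (hg : g ∈ diags own (allV J)) : g.1 = ∅ := by
  obtain ⟨-, h2, -⟩ := (mem_diags own).1 hg
  exact not_nonempty_iff_eq_empty.1 fun hne => none_not_mem_allV (h2 hne)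

/-- The blocks of a diagram on all the clusters form a set partition of ALL the legs. [cite: Balaban1982Higgs1, (3.23) p.616] -/
theorem isSetPartition_of_mem_diags {g : Finset Λ × Finset (Finset Λ)} (hg : g ∈ diags own (allV J)) :
    IsSetPartition (univ : Finset Λ) g.2 := by
  obtain ⟨-, -, h3⟩ := (mem_diags own).1 hg
  have hl : legs own (allV J) = (univ : Finset Λ) := by
    ext l
    simp [mem_legs]
  rwa [fst_eq_empty_of_mem_diags own hg, sdiff_empty, hl] at h3

/-- **CONNECTED DIAGRAMS CONNECT THE LEGS**: if the diagram `g` on all the clusters is connected in p13's sense (no proper subfamily of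
clusters is closed under its blocks), then its blocks together with the intra-cluster pairs join every leg to every other leg (p19's
`Connects`). [cite: Balaban1982Higgs1, (3.23) p.616] -/
theorem connects_of_isConn {g : Finset Λ × Finset (Finset Λ)} (hg : g ∈ diags own (allV J)) (hc : IsConn own (allV J) g) :
    Connects (edgeSet own g) := by
  classical
  intro u w
  set R : Λ → Λ → Prop := fun a b => (a, b) ∈ edgeSet own g with hR
  -- the clusters containing a leg reachable from `u`
  set Q : Finset (Option J) := (allV J).filter fun a => ∃ l, a = some (own l) ∧ Relation.EqvGen R u l with hQ
  have hsep : Sep own g Q := by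
    refine ⟨fun B hB => ?_, fun l hl => ?_⟩
    · by_cases h : ∃ l ∈ B, some (own l) ∈ Q
      · left
        obtain ⟨l, hlB, hlQ⟩ := h
        obtain ⟨-, l₁, hl₁, hul₁⟩ := (mem_filter.1 hlQ)
        have hown : own l₁ = own l := (Option.some_injective _ hl₁).symm
        intro l' hl'
        refine mem_filter.2 ⟨some_mem_allV _, l', rfl, ?_⟩
        have h1 : Relation.EqvGen R l₁ l := Relation.EqvGen.rel _ _ ((mem_edgeSet own).2 (Or.inl hown))
        have h2 : Relation.EqvGen R l l' := Relation.EqvGen.rel _ _ ((mem_edgeSet own).2 (Or.inr ⟨B, hB, hlB, hl'⟩))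
        exact (hul₁.trans _ _ _ h1).trans _ _ _ h2
      · right
        intro l hl hlQ
        exact h ⟨l, hl, hlQ⟩
    · rw [fst_eq_empty_of_mem_diags own hg] at hl
      exact absurd hl (notMem_empty l)
  have hQV : Q ∈ (allV J).powerset := mem_powerset.2 (filter_subset _ _)
  have huQ : some (own u) ∈ Q := mem_filter.2 ⟨some_mem_allV _, u, rfl, Relation.EqvGen.refl _⟩
  rcases hc Q hQV hsep with h | h
  · exact absurd huQ (h ▸ notMem_empty _)
  · have hw : some (own w) ∈ Q := h ▸ some_mem_allV _
    obtain ⟨-, l, hl, hul⟩ := mem_filter.1 hw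
    have hown : own l = own w := (Option.some_injective _ hl).symm
    exact hul.trans _ _ _ (Relation.EqvGen.rel _ _ ((mem_edgeSet own).2 (Or.inl hown)))

omit [Fintype Λ] in
/-- A set partition of a finite set has at most as many blocks as the set has elements. [folklore] [cite: Balaban1982Higgs1, (3.23) p.616] -/
theorem card_le_of_isSetPartition {V : Finset Λ} {π : Finset (Finset Λ)} (h : IsSetPartition V π) : π.card ≤ V.card := by
  calc π.card ≤ (π.biUnion id).card :=
        card_le_card_biUnion h.pairwiseDisjoint fun B hB => h.nonempty_of_mem hB
    _ = V.card := by rw [h.biUnion_id]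

/-- The number of diagrams on all the clusters is at most `2^Q·2^{2^Q}`, `Q` the number of legs (crude: all pairs (observable legs,
family of blocks) are counted). [cite: Balaban1982Higgs1, (3.23) p.616] -/
theorem card_diags_le : ((diags own (allV J)).card : ℝ) ≤ 2 ^ Fintype.card Λ * 2 ^ 2 ^ Fintype.card Λ := by
  have hl : legs own (allV J) = (univ : Finset Λ) := by
    ext l
    simp [mem_legs]
  have h1 : (diags own (allV J)).card ≤ ((univ : Finset Λ).powerset ×ˢ (univ : Finset Λ).powerset.powerset).card := by
    unfold Literature.Probability.LatticeModels.LegDiagram.diags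
    rw [hl]
    exact card_filter_le _ _
  rw [card_product, card_powerset, card_powerset, card_powerset, card_univ] at h1
  exact_mod_cast h1

end Connect

/-! ## §2 Geometry on the torus `T^{(k)}`: the diameter of all the points of a connected diagram -/

section Geometry

variable {P : HiggsLattice.Params} {k : ℕ}
variable {J : Type} [Fintype J] [DecidableEq J] {Λ : Type} [Fintype Λ] [DecidableEq Λ] (own : Λ → J)
  (x : Λ → HiggsLattice.Site P k)

/-- The LENGTH of a block: `Σ_{a,b∈B} |x_a − x_b|` (distance (1.3) in lattice units; for a pair `{l,l′}` this is `2|x_l − x_{l′}|`).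
[cite: Balaban1982Higgs1, (3.23) p.616] -/
def blockLen (B : Finset Λ) : ℝ := ∑ a ∈ B, ∑ b ∈ B, (HiggsLattice.Site.tdist (x a) (x b) : ℝ)

omit [Fintype Λ] [DecidableEq Λ] in
/-- [cite: Balaban1982Higgs1, (3.23) p.616] -/
theorem blockLen_nonneg (B : Finset Λ) : 0 ≤ blockLen x B :=
  sum_nonneg fun _ _ => sum_nonneg fun _ _ => Nat.cast_nonneg _

omit [Fintype Λ] in
/-- The length of a pair is twice the distance of its two points. [cite: Balaban1982Higgs1, (3.23) p.616] -/
theorem blockLen_pair {a b : Λ} (hab : a ≠ b) : blockLen x {a, b} = 2 * (HiggsLattice.Site.tdist (x a) (x b) : ℝ) := by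
  unfold blockLen
  rw [sum_pair hab, sum_pair hab, sum_pair hab, tdist_self, tdist_self, tdist_comm (x b) (x a)]
  push_cast
  ring

/-- The pairs joined by a common block have total length at most the total block length. [cite: Balaban1982Higgs1, (3.23) p.616] -/
theorem sum_blockPairs_le {π : Finset (Finset Λ)} (hπ : IsSetPartition (univ : Finset Λ) π) :
    ∑ p ∈ univ.filter (fun p : Λ × Λ => ∃ B ∈ π, p.1 ∈ B ∧ p.2 ∈ B), (HiggsLattice.Site.tdist (x p.1) (x p.2) : ℝ)
      ≤ ∑ B ∈ π, blockLen x B := by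
  have hsub : univ.filter (fun p : Λ × Λ => ∃ B ∈ π, p.1 ∈ B ∧ p.2 ∈ B) ⊆ π.biUnion fun B => B ×ˢ B := by
    intro p hp
    obtain ⟨B, hB, h1, h2⟩ := (mem_filter.1 hp).2
    exact mem_biUnion.2 ⟨B, hB, mem_product.2 ⟨h1, h2⟩⟩
  have hdisj : (π : Set (Finset Λ)).PairwiseDisjoint fun B => B ×ˢ B := by
    intro B hB B' hB' hne
    exact disjoint_product.2 (Or.inl (hπ.disjoint (mem_coe.1 hB) (mem_coe.1 hB') hne))
  calc ∑ p ∈ univ.filter (fun p : Λ × Λ => ∃ B ∈ π, p.1 ∈ B ∧ p.2 ∈ B), (HiggsLattice.Site.tdist (x p.1) (x p.2) : ℝ)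
      ≤ ∑ p ∈ π.biUnion (fun B => B ×ˢ B), (HiggsLattice.Site.tdist (x p.1) (x p.2) : ℝ) :=
        sum_le_sum_of_subset_of_nonneg hsub fun _ _ _ => Nat.cast_nonneg _
    _ = ∑ B ∈ π, blockLen x B := by
        rw [sum_biUnion hdisj]
        exact sum_congr rfl fun B _ => sum_product _ _ _

/-- **EVERY PAIRWISE DISTANCE OF A CONNECTED DIAGRAM IS CONTROLLED BY THE INTRA-CLUSTER PAIRS AND THE BLOCKS**: for a connected
diagram `g` on all the clusters and legs placed at `x`, `|x_u − x_w| ≦ Σ_{(a,b) same cluster}|x_a − x_b| + Σ_{B∈g} blockLen(B)`.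
[cite: Balaban1982Higgs1, (3.23) p.616] -/
theorem tdist_le_of_isConn {g : Finset Λ × Finset (Finset Λ)} (hg : g ∈ diags own (allV J)) (hc : IsConn own (allV J) g) (u w : Λ) :
    (HiggsLattice.Site.tdist (x u) (x w) : ℝ)
      ≤ (∑ p ∈ univ.filter (fun p : Λ × Λ => own p.1 = own p.2), (HiggsLattice.Site.tdist (x p.1) (x p.2) : ℝ))
        + ∑ B ∈ g.2, blockLen x B := by
  have h1 := le_sum_of_connects (fun a b => (HiggsLattice.Site.tdist (x a) (x b) : ℝ)) (fun a => by simp [tdist_self])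
    (fun a b => by simp [tdist_comm (x a) (x b)]) (fun a b c => tdist_triangle_real (x a) (x b) (x c)) (fun a b => Nat.cast_nonneg _)
    (connects_of_isConn own hg hc) u w
  set S₁ := univ.filter (fun p : Λ × Λ => own p.1 = own p.2) with hS₁
  set S₂ := univ.filter (fun p : Λ × Λ => ∃ B ∈ g.2, p.1 ∈ B ∧ p.2 ∈ B) with hS₂
  set f : Λ × Λ → ℝ := fun p => (HiggsLattice.Site.tdist (x p.1) (x p.2) : ℝ) with hf
  have hf0 : ∀ p, 0 ≤ f p := fun p => Nat.cast_nonneg _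
  -- a union is summed at most once over each part (Mathlib's `sum_union_inter`)
  have hu : ∑ e ∈ S₁ ∪ S₂, f e ≤ ∑ e ∈ S₁, f e + ∑ e ∈ S₂, f e := by
    rw [← sum_union_inter]
    exact le_add_of_nonneg_right (sum_nonneg fun p _ => hf0 p)
  have hS : edgeSet own g = S₁ ∪ S₂ := by
    rw [edgeSet, filter_or]
  rw [hS] at h1
  exact h1.trans (hu.trans (add_le_add le_rfl (sum_blockPairs_le x (isSetPartition_of_mem_diags own hg))))

end Geometry

/-! ## §3 Colourings by the monomial index of (3.57), their legs, and the bound for ONE colouring -/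

section Colouring

variable {P : HiggsLattice.Params} {k : ℕ} {Lbl : Type} {n qmax : ℕ}

/-- THE MONOMIAL INDEX OF (3.57) (a "colour" of a cluster): total degree `q ≦ qmax`, argument points `z : Fin q → T^{(k)}`, leg labels
`κ : Fin q → Lbl` — the typer's `B1Eq357FluctuationPolynomial.Idx P N k qmax` at `Lbl = Leg N P.d` (`{1,…,N} ⊔ {1,…,d}`).
[cite: Balaban1982Higgs1, Prop. 3.2 (3.57) p.622] -/
abbrev Col (P : HiggsLattice.Params) (k qmax : ℕ) (Lbl : Type) : Type :=
  Σ q : Fin (qmax + 1), (Fin q → HiggsLattice.Site P k) × (Fin q → Lbl)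

/-- THE LEGS of a colouring `z` of the `n` clusters: cluster `j` owns the legs `(j, i)`, `i < q_j` (p33's `B3GaussianPerturbationGraphs.Leg deg z`
at `deg c = c.1`). [cite: Balaban1982Higgs1, (3.23) p.616] -/
abbrev Legs (z : Fin n → Col P k qmax Lbl) : Type := Σ j : Fin n, Fin ((z j).1 : ℕ)

/-- The position of a leg: the leg `(j, i)` sits at the `i`-th argument point of the monomial of cluster `j`.
[cite: Balaban1982Higgs1, Prop. 3.2 (3.57) p.622] -/
def pos (z : Fin n → Col P k qmax Lbl) (l : Legs z) : HiggsLattice.Site P k := (z l.1).2.1 l.2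

/-- The DIAMETER OF ALL THE POINTS of a colouring (distance (1.3), lattice units of `T^{(k)}`). [cite: Balaban1982Higgs1, (3.23) p.616] -/
def allDiam (z : Fin n → Col P k qmax Lbl) : ℕ :=
  univ.sup fun a : Legs z => univ.sup fun b : Legs z => HiggsLattice.Site.tdist (pos z a) (pos z b)

/-- [cite: Balaban1982Higgs1, (3.23) p.616] -/
theorem tdist_le_allDiam (z : Fin n → Col P k qmax Lbl) (a b : Legs z) : HiggsLattice.Site.tdist (pos z a) (pos z b) ≤ allDiam z := by
  unfold allDiam
  exact (Finset.le_sup (f := fun b => HiggsLattice.Site.tdist (pos z a) (pos z b)) (mem_univ b)).trans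
    (Finset.le_sup (f := fun a => univ.sup fun b => HiggsLattice.Site.tdist (pos z a) (pos z b)) (mem_univ a))

/-- [cite: Balaban1982Higgs1, (3.23) p.616] -/
theorem allDiam_le_of_forall (z : Fin n → Col P k qmax Lbl) {m : ℕ} (h : ∀ a b, HiggsLattice.Site.tdist (pos z a) (pos z b) ≤ m) :
    allDiam z ≤ m :=
  Finset.sup_le fun a _ => Finset.sup_le fun b _ => h a b

/-- The number of legs of a colouring is `Q = Σ_j q_j ≦ n·qmax`. [cite: Balaban1982Higgs1, Prop. 3.2 (3.57) p.622] -/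
theorem card_legs_eq (z : Fin n → Col P k qmax Lbl) : Fintype.card (Legs z) = ∑ j, ((z j).1 : ℕ) := by
  rw [Fintype.card_sigma]
  exact sum_congr rfl fun j _ => Fintype.card_fin _

/-- [cite: Balaban1982Higgs1, Prop. 3.2 (3.57) p.622] -/
theorem deg_le (z : Fin n → Col P k qmax Lbl) (j : Fin n) : ((z j).1 : ℕ) ≤ qmax := Nat.lt_succ_iff.1 (z j).1.isLt

/-- [cite: Balaban1982Higgs1, Prop. 3.2 (3.57) p.622] -/
theorem card_legs_le (z : Fin n → Col P k qmax Lbl) : Fintype.card (Legs z) ≤ n * qmax := by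
  rw [card_legs_eq]
  calc ∑ j, ((z j).1 : ℕ) ≤ ∑ _j : Fin n, qmax := sum_le_sum fun j _ => deg_le z j
    _ = n * qmax := by rw [sum_const, card_univ, Fintype.card_fin, smul_eq_mul]

/-- THE CONNECTED-GRAPH SUM OF ONE COLOURING: over the connected diagrams on the `n` clusters (p13's `LegDiagram.diags`/`IsConn`, owner map =
the cluster of a leg), the product of the block weights — the right member of p33's `ursellOf_jmoment_univ` for one colouring.
[cite: Balaban1982Higgs1, (3.23) p.616] -/
def connSum (w : (z : Fin n → Col P k qmax Lbl) → Finset (Legs z) → ℝ) (z : Fin n → Col P k qmax Lbl) : ℝ :=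
  ∑ g ∈ (diags (Sigma.fst : Legs z → Fin n) (allV (Fin n))).filter (IsConn (Sigma.fst : Legs z → Fin n) (allV (Fin n))),
    ∏ B ∈ g.2, w z B

/-- The intra-cluster pairs have total length `≦ Q·Σ_j q_j·diam z_j`. [cite: Balaban1982Higgs1, (3.23) p.616] -/
theorem sum_sameCluster_le (z : Fin n → Col P k qmax Lbl) :
    ∑ p ∈ univ.filter (fun p : Legs z × Legs z => p.1.1 = p.2.1), (HiggsLattice.Site.tdist (pos z p.1) (pos z p.2) : ℝ)
      ≤ (Fintype.card (Legs z) : ℝ) * ∑ j, ((z j).1 : ℝ) * (diam (z j).2.1 : ℝ) := by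
  set D : Fin n → ℝ := fun j => (diam (z j).2.1 : ℝ) with hD
  have hDnn : ∀ j, 0 ≤ D j := fun j => Nat.cast_nonneg _
  -- termwise: a same-cluster pair is within the diameter of its cluster's points
  have h1 : ∑ p ∈ univ.filter (fun p : Legs z × Legs z => p.1.1 = p.2.1), (HiggsLattice.Site.tdist (pos z p.1) (pos z p.2) : ℝ)
      ≤ ∑ p ∈ univ.filter (fun p : Legs z × Legs z => p.1.1 = p.2.1), D p.1.1 := by
    refine sum_le_sum fun p hp => ?_
    have h := (mem_filter.1 hp).2
    obtain ⟨⟨j, i⟩, ⟨j', i'⟩⟩ := p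
    simp only at h
    subst h
    simp only [hD, pos]
    exact_mod_cast tdist_le_diam (z j).2.1 i i'
  have h2 : ∑ p ∈ univ.filter (fun p : Legs z × Legs z => p.1.1 = p.2.1), D p.1.1 ≤ ∑ p : Legs z × Legs z, D p.1.1 :=
    sum_le_sum_of_subset_of_nonneg (filter_subset _ _) fun p _ _ => hDnn _
  have h3 : ∑ p : Legs z × Legs z, D p.1.1 = (Fintype.card (Legs z) : ℝ) * ∑ a : Legs z, D a.1 := by
    rw [Fintype.sum_prod_type, mul_sum]
    refine sum_congr rfl fun a _ => ?_
    show ∑ _b : Legs z, D a.1 = _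
    rw [sum_const, card_univ, nsmul_eq_mul]
  have h4 : ∑ a : Legs z, D a.1 = ∑ j, ((z j).1 : ℝ) * D j := by
    rw [Fintype.sum_sigma]
    refine sum_congr rfl fun j _ => ?_
    show ∑ _i : Fin ((z j).1 : ℕ), D j = _
    rw [sum_const, card_univ, Fintype.card_fin, nsmul_eq_mul]
  calc _ ≤ _ := h1
    _ ≤ _ := h2
    _ = _ := by rw [h3, h4]

/-- **THE DIAMETER OF ALL THE POINTS OF A CONNECTED DIAGRAM** is at most `Q·Σ_j q_j·diam z_j + Σ_{B} blockLen(B)`.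
[cite: Balaban1982Higgs1, (3.23) p.616] -/
theorem allDiam_le_of_isConn (z : Fin n → Col P k qmax Lbl) {g : Finset (Legs z) × Finset (Finset (Legs z))}
    (hg : g ∈ diags (Sigma.fst : Legs z → Fin n) (allV (Fin n))) (hc : IsConn (Sigma.fst : Legs z → Fin n) (allV (Fin n)) g) :
    (allDiam z : ℝ) ≤ (Fintype.card (Legs z) : ℝ) * (∑ j, ((z j).1 : ℝ) * (diam (z j).2.1 : ℝ)) + ∑ B ∈ g.2, blockLen (pos z) B := by
  set X : ℝ := (Fintype.card (Legs z) : ℝ) * (∑ j, ((z j).1 : ℝ) * (diam (z j).2.1 : ℝ)) + ∑ B ∈ g.2, blockLen (pos z) B with hX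
  have hX0 : 0 ≤ X := add_nonneg (mul_nonneg (Nat.cast_nonneg _) (sum_nonneg fun j _ => mul_nonneg (Nat.cast_nonneg _) (Nat.cast_nonneg _)))
    (sum_nonneg fun B _ => blockLen_nonneg _ B)
  have hpair : ∀ a b : Legs z, (HiggsLattice.Site.tdist (pos z a) (pos z b) : ℝ) ≤ X := fun a b =>
    (tdist_le_of_isConn (Sigma.fst : Legs z → Fin n) (pos z) hg hc a b).trans (add_le_add (sum_sameCluster_le z) le_rfl)
  have hfloor : allDiam z ≤ ⌊X⌋₊ := allDiam_le_of_forall z fun a b => Nat.le_floor (hpair a b)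
  calc (allDiam z : ℝ) ≤ (⌊X⌋₊ : ℝ) := by exact_mod_cast hfloor
    _ ≤ X := Nat.floor_le hX0

/-- THE DECAY RATE of the combined estimate: `δ′ = min(δ₁/2, δ₀/(n·qmax² + 1))`. [cite: Balaban1982Higgs1, (3.23) p.616] -/
def rate (n qmax : ℕ) (δ₀ δ₁ : ℝ) : ℝ := min (δ₁ / 2) (δ₀ / (n * qmax ^ 2 + 1))

/-- [cite: Balaban1982Higgs1, (3.23) p.616] -/
theorem rate_pos (n qmax : ℕ) {δ₀ δ₁ : ℝ} (hδ₀ : 0 < δ₀) (hδ₁ : 0 < δ₁) : 0 < rate n qmax δ₀ δ₁ :=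
  lt_min (by linarith) (div_pos hδ₀ (by positivity))

/-- [cite: Balaban1982Higgs1, (3.23) p.616] -/
theorem rate_le_half (n qmax : ℕ) (δ₀ δ₁ : ℝ) : rate n qmax δ₀ δ₁ ≤ δ₁ / 2 := min_le_left _ _

/-- [cite: Balaban1982Higgs1, (3.23) p.616] -/
theorem rate_mul_le (n qmax : ℕ) {δ₀ : ℝ} (hδ₀ : 0 ≤ δ₀) (δ₁ : ℝ) : rate n qmax δ₀ δ₁ * (n * qmax ^ 2) ≤ δ₀ := by
  have h1 : rate n qmax δ₀ δ₁ ≤ δ₀ / (n * qmax ^ 2 + 1) := min_le_right _ _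
  have hpos : (0 : ℝ) < n * qmax ^ 2 + 1 := by positivity
  calc rate n qmax δ₀ δ₁ * (n * qmax ^ 2) ≤ δ₀ / (n * qmax ^ 2 + 1) * (n * qmax ^ 2) :=
        mul_le_mul_of_nonneg_right h1 (by positivity)
    _ ≤ δ₀ / (n * qmax ^ 2 + 1) * (n * qmax ^ 2 + 1) := mul_le_mul_of_nonneg_left (by linarith) (div_nonneg hδ₀ hpos.le)
    _ = δ₀ := div_mul_cancel₀ δ₀ hpos.ne'

/-- THE DIAGRAM COUNT bound `2^Q·2^{2^Q}` (crude). [cite: Balaban1982Higgs1, (3.23) p.616] -/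
def diagBound (Q : ℕ) : ℝ := 2 ^ Q * 2 ^ 2 ^ Q

/-- [cite: Balaban1982Higgs1, (3.23) p.616] -/
theorem diagBound_mono {Q Q' : ℕ} (h : Q ≤ Q') : diagBound Q ≤ diagBound Q' := by
  unfold diagBound
  gcongr <;> norm_num

/-- [cite: Balaban1982Higgs1, (3.23) p.616] -/
theorem one_le_diagBound (Q : ℕ) : 1 ≤ diagBound Q :=
  one_le_mul_of_one_le_of_one_le (one_le_pow₀ (by norm_num)) (one_le_pow₀ (by norm_num))

variable (coef : Fin n → Col P k qmax Lbl → ℝ) (w : (z : Fin n → Col P k qmax Lbl) → Finset (Legs z) → ℝ)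
  {A₀ δ₀ c₀ δ₁ : ℝ}

/-- The coefficients of one colouring: `Π_j |a_j(z_j)| ≦ A₀ⁿ·e^{−δ₀Σ_j diam z_j}` under (3.58) (diameter currency).
[cite: Balaban1982Higgs1, Prop. 3.2 (3.58) p.622] -/
theorem prod_abs_coef_le (hcoef : ∀ j c, |coef j c| ≤ A₀ * Real.exp (-(δ₀ * (diam c.2.1 : ℝ)))) (z : Fin n → Col P k qmax Lbl) :
    ∏ j, |coef j (z j)| ≤ A₀ ^ n * Real.exp (-(δ₀ * ∑ j, (diam (z j).2.1 : ℝ))) := by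
  calc ∏ j, |coef j (z j)| ≤ ∏ j, A₀ * Real.exp (-(δ₀ * (diam (z j).2.1 : ℝ))) :=
        prod_le_prod (fun j _ => abs_nonneg _) fun j _ => hcoef j (z j)
    _ = A₀ ^ n * Real.exp (-(δ₀ * ∑ j, (diam (z j).2.1 : ℝ))) := by
        rw [prod_mul_distrib, prod_const, card_univ, Fintype.card_fin, ← Real.exp_sum, mul_sum, ← sum_neg_distrib]

/-- The weights of one diagram on all the clusters: `Π_B |w_z(B)| ≦ max(1,c₀)^Q·e^{−(δ₁/2)Σ_B blockLen(B)}` (*"exponentially decaying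
propagators"*; a diagram with a block that is not a pair has weight `0`). [cite: Balaban1982Higgs1, (3.23) p.616] -/
theorem prod_abs_w_le (hc₀ : 0 ≤ c₀)
    (hw2 : ∀ z (a b : Legs z), a ≠ b →
      |w z {a, b}| ≤ c₀ * Real.exp (-(δ₁ * (HiggsLattice.Site.tdist (pos z a) (pos z b) : ℝ))))
    (hw0 : ∀ z (B : Finset (Legs z)), B.card ≠ 2 → w z B = 0)
    (z : Fin n → Col P k qmax Lbl) {g : Finset (Legs z) × Finset (Finset (Legs z))}
    (hg : g ∈ diags (Sigma.fst : Legs z → Fin n) (allV (Fin n))) :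
    ∏ B ∈ g.2, |w z B| ≤ (max 1 c₀) ^ Fintype.card (Legs z) * Real.exp (-(δ₁ / 2 * ∑ B ∈ g.2, blockLen (pos z) B)) := by
  have hπ := isSetPartition_of_mem_diags (Sigma.fst : Legs z → Fin n) hg
  by_cases hall : ∀ B ∈ g.2, B.card = 2
  · have hB : ∀ B ∈ g.2, |w z B| ≤ c₀ * Real.exp (-(δ₁ / 2 * blockLen (pos z) B)) := by
      intro B hB
      obtain ⟨a, b, hab, rfl⟩ := card_eq_two.1 (hall B hB)
      rw [blockLen_pair (pos z) hab]
      have : δ₁ / 2 * (2 * (HiggsLattice.Site.tdist (pos z a) (pos z b) : ℝ)) = δ₁ * (HiggsLattice.Site.tdist (pos z a) (pos z b) : ℝ) := by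
        ring
      rw [this]
      exact hw2 z a b hab
    calc ∏ B ∈ g.2, |w z B| ≤ ∏ B ∈ g.2, c₀ * Real.exp (-(δ₁ / 2 * blockLen (pos z) B)) :=
          prod_le_prod (fun B _ => abs_nonneg _) hB
      _ = c₀ ^ g.2.card * Real.exp (-(δ₁ / 2 * ∑ B ∈ g.2, blockLen (pos z) B)) := by
          rw [prod_mul_distrib, prod_const, ← Real.exp_sum, mul_sum, ← sum_neg_distrib]
      _ ≤ (max 1 c₀) ^ Fintype.card (Legs z) * Real.exp (-(δ₁ / 2 * ∑ B ∈ g.2, blockLen (pos z) B)) := by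
          refine mul_le_mul_of_nonneg_right ?_ (Real.exp_nonneg _)
          calc c₀ ^ g.2.card ≤ (max 1 c₀) ^ g.2.card := pow_le_pow_left₀ hc₀ (le_max_right _ _) _
            _ ≤ (max 1 c₀) ^ Fintype.card (Legs z) :=
                pow_le_pow_right₀ (le_max_left _ _) ((card_le_of_isSetPartition hπ).trans (card_univ (α := Legs z)).le)
  · push Not at hall
    obtain ⟨B₀, hB₀, hB₀c⟩ := hall
    rw [prod_eq_zero hB₀ (by rw [hw0 z B₀ hB₀c, abs_zero])]
    positivity

/-- **THE BOUND FOR ONE COLOURING**: for a connected diagram ALL the decay factors combine into `e^{−δ′·(diameter of all the points)}`,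
so `|Π_j a_j(z_j)|·|connected-graph sum of z| ≦ diagBound(Q)·max(1,c₀)^Q·A₀ⁿ·e^{−δ′·allDiam z}`. [cite: Balaban1982Higgs1, (3.23) p.616] -/
theorem abs_term_le (hA₀ : 0 ≤ A₀) (hδ₀ : 0 ≤ δ₀) (hc₀ : 0 ≤ c₀) (hδ₁ : 0 < δ₁)
    (hcoef : ∀ j c, |coef j c| ≤ A₀ * Real.exp (-(δ₀ * (diam c.2.1 : ℝ))))
    (hw2 : ∀ z (a b : Legs z), a ≠ b →
      |w z {a, b}| ≤ c₀ * Real.exp (-(δ₁ * (HiggsLattice.Site.tdist (pos z a) (pos z b) : ℝ))))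
    (hw0 : ∀ z (B : Finset (Legs z)), B.card ≠ 2 → w z B = 0) (z : Fin n → Col P k qmax Lbl) :
    |(∏ j, coef j (z j)) * connSum w z|
      ≤ diagBound (Fintype.card (Legs z)) * ((max 1 c₀) ^ Fintype.card (Legs z) * A₀ ^ n
          * Real.exp (-(rate n qmax δ₀ δ₁ * (allDiam z : ℝ)))) := by
  set Q := Fintype.card (Legs z) with hQ
  set δ' := rate n qmax δ₀ δ₁ with hδ'
  have hδ'0 : 0 ≤ δ' := le_min (by linarith) (div_nonneg hδ₀ (by positivity))
  set F := (diags (Sigma.fst : Legs z → Fin n) (allV (Fin n))).filter (IsConn (Sigma.fst : Legs z → Fin n) (allV (Fin n))) with hF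
  set M : ℝ := (max 1 c₀) ^ Q * A₀ ^ n * Real.exp (-(δ' * (allDiam z : ℝ))) with hM
  have hM0 : 0 ≤ M := by positivity
  -- each connected diagram contributes at most `M`
  have hterm : ∀ g ∈ F, (∏ j, |coef j (z j)|) * ∏ B ∈ g.2, |w z B| ≤ M := by
    intro g hgF
    obtain ⟨hg, hc⟩ := mem_filter.1 hgF
    have h1 := prod_abs_coef_le coef hcoef z
    have h2 := prod_abs_w_le w hc₀ hw2 hw0 z hg
    have h3 := allDiam_le_of_isConn z hg hc
    set SD : ℝ := ∑ j, (diam (z j).2.1 : ℝ) with hSD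
    set SB : ℝ := ∑ B ∈ g.2, blockLen (pos z) B with hSB
    have hSD0 : 0 ≤ SD := sum_nonneg fun j _ => Nat.cast_nonneg _
    have hSB0 : 0 ≤ SB := sum_nonneg fun B _ => blockLen_nonneg _ B
    -- the weighted degrees: `Q·Σ_j q_j·diam_j ≦ n·qmax²·Σ_j diam_j`
    have hdeg : (Q : ℝ) * ∑ j, ((z j).1 : ℝ) * (diam (z j).2.1 : ℝ) ≤ (n * qmax ^ 2 : ℝ) * SD := by
      have hq : ∑ j, ((z j).1 : ℝ) * (diam (z j).2.1 : ℝ) ≤ (qmax : ℝ) * SD := by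
        rw [hSD, mul_sum]
        exact sum_le_sum fun j _ => mul_le_mul_of_nonneg_right (by exact_mod_cast deg_le z j) (Nat.cast_nonneg _)
      have hQle : (Q : ℝ) ≤ n * qmax := by exact_mod_cast card_legs_le z
      calc (Q : ℝ) * ∑ j, ((z j).1 : ℝ) * (diam (z j).2.1 : ℝ) ≤ (n * qmax : ℝ) * ((qmax : ℝ) * SD) :=
            mul_le_mul hQle hq (sum_nonneg fun j _ => mul_nonneg (Nat.cast_nonneg _) (Nat.cast_nonneg _)) (by positivity)
        _ = (n * qmax ^ 2 : ℝ) * SD := by ring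
    -- the exponent comparison `δ′·allDiam ≦ δ₀·SD + (δ₁/2)·SB`
    have hexp : δ' * (allDiam z : ℝ) ≤ δ₀ * SD + δ₁ / 2 * SB := by
      calc δ' * (allDiam z : ℝ) ≤ δ' * ((n * qmax ^ 2 : ℝ) * SD + SB) :=
            mul_le_mul_of_nonneg_left (h3.trans (add_le_add hdeg le_rfl)) hδ'0
        _ = δ' * (n * qmax ^ 2) * SD + δ' * SB := by ring
        _ ≤ δ₀ * SD + δ₁ / 2 * SB :=
            add_le_add (mul_le_mul_of_nonneg_right (rate_mul_le n qmax hδ₀ δ₁) hSD0)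
              (mul_le_mul_of_nonneg_right (rate_le_half n qmax δ₀ δ₁) hSB0)
    calc (∏ j, |coef j (z j)|) * ∏ B ∈ g.2, |w z B|
        ≤ (A₀ ^ n * Real.exp (-(δ₀ * SD))) * ((max 1 c₀) ^ Q * Real.exp (-(δ₁ / 2 * SB))) :=
          mul_le_mul h1 h2 (prod_nonneg fun B _ => abs_nonneg _) (by positivity)
      _ = (max 1 c₀) ^ Q * A₀ ^ n * Real.exp (-(δ₀ * SD + δ₁ / 2 * SB)) := by
          rw [neg_add, Real.exp_add]; ring
      _ ≤ M := mul_le_mul_of_nonneg_left (Real.exp_le_exp.2 (neg_le_neg hexp)) (by positivity)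
  -- sum over the connected diagrams and count them
  have hcard : (F.card : ℝ) ≤ diagBound Q := by
    calc (F.card : ℝ) ≤ ((diags (Sigma.fst : Legs z → Fin n) (allV (Fin n))).card : ℝ) := by
          exact_mod_cast card_filter_le _ _
      _ ≤ 2 ^ Q * 2 ^ 2 ^ Q := card_diags_le (Sigma.fst : Legs z → Fin n)
      _ = diagBound Q := rfl
  calc |(∏ j, coef j (z j)) * connSum w z|
      = (∏ j, |coef j (z j)|) * |∑ g ∈ F, ∏ B ∈ g.2, w z B| := by rw [abs_mul, Finset.abs_prod]; rfl
    _ ≤ (∏ j, |coef j (z j)|) * ∑ g ∈ F, |∏ B ∈ g.2, w z B| :=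
        mul_le_mul_of_nonneg_left (abs_sum_le_sum_abs _ _) (prod_nonneg fun j _ => abs_nonneg _)
    _ = ∑ g ∈ F, (∏ j, |coef j (z j)|) * ∏ B ∈ g.2, |w z B| := by
        rw [mul_sum]
        exact sum_congr rfl fun g _ => by rw [Finset.abs_prod]
    _ ≤ ∑ _g ∈ F, M := sum_le_sum hterm
    _ = (F.card : ℝ) * M := by rw [sum_const, nsmul_eq_mul]
    _ ≤ diagBound Q * M := mul_le_mul_of_nonneg_right hcard hM0

end Colouring

/-! ## §4 Re-indexing the colourings: degrees, then points and labels; the points as ONE tuple -/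

section Reindex

variable {P : HiggsLattice.Params} {k : ℕ} {Lbl : Type} {n qmax : ℕ}

/-- The colouring with degrees `qv`, points `pts` and labels `lbl`. [cite: Balaban1982Higgs1, Prop. 3.2 (3.57) p.622] -/
def mkCol (qv : Fin n → Fin (qmax + 1)) (pts : (j : Fin n) → Fin (qv j : ℕ) → HiggsLattice.Site P k)
    (lbl : (j : Fin n) → Fin (qv j : ℕ) → Lbl) : Fin n → Col P k qmax Lbl :=
  fun j => ⟨qv j, (pts j, lbl j)⟩

/-- Colourings ≃ (degrees, points, labels). [cite: Balaban1982Higgs1, Prop. 3.2 (3.57) p.622] -/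
def colEquiv : (Fin n → Col P k qmax Lbl) ≃
    Σ qv : Fin n → Fin (qmax + 1),
      ((j : Fin n) → Fin (qv j : ℕ) → HiggsLattice.Site P k) × ((j : Fin n) → Fin (qv j : ℕ) → Lbl) where
  toFun z := ⟨fun j => (z j).1, (fun j => (z j).2.1, fun j => (z j).2.2)⟩
  invFun s := mkCol s.1 s.2.1 s.2.2
  left_inv _ := rfl
  right_inv _ := rfl

/-- [cite: Balaban1982Higgs1, Prop. 3.2 (3.57) p.622] -/
theorem colEquiv_symm_apply (s : Σ qv : Fin n → Fin (qmax + 1),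
      ((j : Fin n) → Fin (qv j : ℕ) → HiggsLattice.Site P k) × ((j : Fin n) → Fin (qv j : ℕ) → Lbl)) :
    (colEquiv (P := P) (k := k) (Lbl := Lbl)).symm s = mkCol s.1 s.2.1 s.2.2 := rfl

/-- Evaluating a cluster-indexed family at equal legs. [folklore] [cite: Balaban1982Higgs1, Prop. 3.2 (3.57) p.622] -/
theorem apply_leg_congr {qv : Fin n → Fin (qmax + 1)} {S : Type} (pts : (j : Fin n) → Fin (qv j : ℕ) → S)
    {X Y : Σ j : Fin n, Fin (qv j : ℕ)} (h : X = Y) : pts X.1 X.2 = pts Y.1 Y.2 := by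
  subst h
  rfl

/-- The concatenation of the point tuples of the clusters into ONE tuple of `Q = Σ_j q_j` points (Mathlib's `finSigmaFinEquiv`).
[cite: Balaban1982Higgs1, Prop. 3.2 (3.57) p.622] -/
def ptsEquiv (qv : Fin n → Fin (qmax + 1)) :
    ((j : Fin n) → Fin (qv j : ℕ) → HiggsLattice.Site P k) ≃ (Fin (∑ j, (qv j : ℕ)) → HiggsLattice.Site P k) where
  toFun pts m := pts ((finSigmaFinEquiv (n := fun j => (qv j : ℕ))).symm m).1 ((finSigmaFinEquiv (n := fun j => (qv j : ℕ))).symm m).2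
  invFun y j i := y (finSigmaFinEquiv (n := fun j => (qv j : ℕ)) ⟨j, i⟩)
  left_inv pts := by
    funext j i
    exact apply_leg_congr pts ((finSigmaFinEquiv (n := fun j => (qv j : ℕ))).symm_apply_apply ⟨j, i⟩)
  right_inv y := by
    funext m
    simp only [Sigma.eta, Equiv.apply_symm_apply]

/-- The diameter of the concatenated tuple is at most the diameter of all the points of the colouring (in fact equal).
[cite: Balaban1982Higgs1, (3.23) p.616] -/
theorem diam_ptsEquiv_le (qv : Fin n → Fin (qmax + 1)) (pts : (j : Fin n) → Fin (qv j : ℕ) → HiggsLattice.Site P k)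
    (lbl : (j : Fin n) → Fin (qv j : ℕ) → Lbl) :
    diam (ptsEquiv qv pts) ≤ allDiam (mkCol qv pts lbl) :=
  diam_le_of_forall _ fun m m' =>
    tdist_le_allDiam (mkCol qv pts lbl) ((finSigmaFinEquiv (n := fun j => (qv j : ℕ))).symm m)
      ((finSigmaFinEquiv (n := fun j => (qv j : ℕ))).symm m')

/-- The number of label patterns of given degrees is `|Lbl|^Q`. [cite: Balaban1982Higgs1, Prop. 3.2 (3.57) p.622] -/
theorem card_labels [Fintype Lbl] (qv : Fin n → Fin (qmax + 1)) :
    Fintype.card ((j : Fin n) → Fin (qv j : ℕ) → Lbl) = Fintype.card Lbl ^ (∑ j, (qv j : ℕ)) := by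
  rw [Fintype.card_pi]
  simp only [Fintype.card_fun, Fintype.card_fin]
  exact prod_pow_eq_pow_sum _ _ _

end Reindex

/-! ## §5 The volume bound for the connected-graph sum over all colourings -/

section Main

variable {P : HiggsLattice.Params} {k : ℕ} {Lbl : Type} {n qmax : ℕ}

/-- **THE CONSTANT** of the volume bound (explicit; depends on `d`, the number of leg labels, `n`, `qmax`, `c₀`, `δ₀`, `δ₁` — NOT on the torus,
`k` or `ε`): `diagBound(n·qmax)·max(1,c₀)^{n·qmax}·Σ_{degrees q ∈ {0..qmax}ⁿ} |Lbl|^{Σq}·treeConst_d(δ′)_{Σq}`. Print: "O(1)".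
[cite: Balaban1982Higgs1, (3.23) p.616] -/
def connConst (d nLbl n qmax : ℕ) (c₀ δ₀ δ₁ : ℝ) : ℝ :=
  diagBound (n * qmax) * (max 1 c₀) ^ (n * qmax) *
    ∑ qv : Fin n → Fin (qmax + 1), (nLbl : ℝ) ^ (∑ j, (qv j : ℕ)) * treeConst d (rate n qmax δ₀ δ₁) (∑ j, (qv j : ℕ))

/-- [cite: Balaban1982Higgs1, (3.23) p.616] -/
theorem connConst_nonneg (d nLbl n qmax : ℕ) (c₀ : ℝ) {δ₀ δ₁ : ℝ} (hδ₀ : 0 < δ₀) (hδ₁ : 0 < δ₁) :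
    0 ≤ connConst d nLbl n qmax c₀ δ₀ δ₁ := by
  unfold connConst
  refine mul_nonneg (mul_nonneg (zero_le_one.trans (one_le_diagBound _)) (pow_nonneg (zero_le_one.trans (le_max_left _ _)) _))
    (sum_nonneg fun qv _ => mul_nonneg (pow_nonneg (Nat.cast_nonneg _) _) (treeConst_nonneg d (rate_pos n qmax hδ₀ hδ₁).le _))

variable (coef : Fin n → Col P k qmax Lbl → ℝ) (w : (z : Fin n → Col P k qmax Lbl) → Finset (Legs z) → ℝ)
  {A₀ δ₀ c₀ δ₁ : ℝ}

/-- The tree-decay summation over all colourings: `Σ_z e^{−δ′·allDiam z} ≦ |T^{(k)}|·Σ_{q} |Lbl|^{Σq}·treeConst(δ′)_{Σq}`.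
[cite: Balaban1982Higgs1, (3.23) p.616] -/
theorem sum_exp_neg_allDiam_le [Fintype Lbl] {δ : ℝ} (hδ : 0 < δ) :
    ∑ z : Fin n → Col P k qmax Lbl, Real.exp (-(δ * (allDiam z : ℝ)))
      ≤ (Fintype.card (HiggsLattice.Site P k) : ℝ) *
          ∑ qv : Fin n → Fin (qmax + 1), (Fintype.card Lbl : ℝ) ^ (∑ j, (qv j : ℕ)) * treeConst P.d δ (∑ j, (qv j : ℕ)) := by
  rw [← (colEquiv (P := P) (k := k) (Lbl := Lbl)).symm.sum_comp, Fintype.sum_sigma, mul_sum]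
  refine sum_le_sum fun qv _ => ?_
  rw [Fintype.sum_prod_type]
  -- pointwise: the decay of a colouring is at most the decay of its concatenated point tuple
  have hpt : ∀ (pts : (j : Fin n) → Fin (qv j : ℕ) → HiggsLattice.Site P k) (lbl : (j : Fin n) → Fin (qv j : ℕ) → Lbl),
      Real.exp (-(δ * (allDiam (mkCol qv pts lbl) : ℝ))) ≤ Real.exp (-(δ * (diam (ptsEquiv qv pts) : ℝ))) := fun pts lbl =>
    Real.exp_le_exp.2 (neg_le_neg (mul_le_mul_of_nonneg_left (by exact_mod_cast diam_ptsEquiv_le qv pts lbl) hδ.le))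
  calc ∑ pts : (j : Fin n) → Fin (qv j : ℕ) → HiggsLattice.Site P k, ∑ lbl : (j : Fin n) → Fin (qv j : ℕ) → Lbl,
          Real.exp (-(δ * (allDiam ((colEquiv (P := P) (k := k) (Lbl := Lbl)).symm ⟨qv, (pts, lbl)⟩) : ℝ)))
      ≤ ∑ pts : (j : Fin n) → Fin (qv j : ℕ) → HiggsLattice.Site P k, ∑ _lbl : (j : Fin n) → Fin (qv j : ℕ) → Lbl,
          Real.exp (-(δ * (diam (ptsEquiv qv pts) : ℝ))) := sum_le_sum fun pts _ => sum_le_sum fun lbl _ => hpt pts lbl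
    _ = (Fintype.card Lbl : ℝ) ^ (∑ j, (qv j : ℕ)) *
          ∑ pts : (j : Fin n) → Fin (qv j : ℕ) → HiggsLattice.Site P k, Real.exp (-(δ * (diam (ptsEquiv qv pts) : ℝ))) := by
        rw [mul_sum]
        refine sum_congr rfl fun pts _ => ?_
        rw [sum_const, card_univ, card_labels, nsmul_eq_mul, Nat.cast_pow]
    _ = (Fintype.card Lbl : ℝ) ^ (∑ j, (qv j : ℕ)) *
          ∑ y : Fin (∑ j, (qv j : ℕ)) → HiggsLattice.Site P k, Real.exp (-(δ * (diam y : ℝ))) := by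
        rw [← (ptsEquiv (P := P) (k := k) qv).sum_comp]
    _ ≤ (Fintype.card Lbl : ℝ) ^ (∑ j, (qv j : ℕ)) *
          ((Fintype.card (HiggsLattice.Site P k) : ℝ) * treeConst P.d δ (∑ j, (qv j : ℕ))) :=
        mul_le_mul_of_nonneg_left (sum_exp_neg_diam_le_treeConst hδ _) (pow_nonneg (Nat.cast_nonneg _) _)
    _ = (Fintype.card (HiggsLattice.Site P k) : ℝ) *
          ((Fintype.card Lbl : ℝ) ^ (∑ j, (qv j : ℕ)) * treeConst P.d δ (∑ j, (qv j : ℕ))) := by ring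

/-- **THE VOLUME BOUND FOR THE SUM OVER CONNECTED GRAPHS** (p. 616: *"⟨Vⁿ⟩^T is the expression corresponding to the sum of connected graphs
with exponentially decaying propagators. Hence ⟨Vⁿ⟩^T = O(ε^κ)|T₁|"*): for `n` clusters coloured by the monomials of (3.57) with coefficients
obeying (3.58) in the diameter currency (`|a_j(q;z;κ)| ≦ A₀e^{−δ₀·diam z}`, `A₀ ≧ 0`, `δ₀ > 0`) and block weights that are exponentially
decaying propagators on pairs (`|w_z{l,l′}| ≦ c₀e^{−δ₁|x_l−x_{l′}|}`, `c₀ ≧ 0`, `δ₁ > 0`) and vanish on the other blocks,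
  `|Σ_{z : Fin n → Col} (Π_j a_j(z_j)) · Σ_{g connected} Π_{B∈g} w_z(B)| ≦ connConst · A₀ⁿ · |T^{(k)}|`.
[cite: Balaban1982Higgs1, (3.23) p.616] -/
theorem abs_connectedSum_le [Fintype Lbl] (hA₀ : 0 ≤ A₀) (hδ₀ : 0 < δ₀) (hc₀ : 0 ≤ c₀) (hδ₁ : 0 < δ₁)
    (hcoef : ∀ j c, |coef j c| ≤ A₀ * Real.exp (-(δ₀ * (diam c.2.1 : ℝ))))
    (hw2 : ∀ z (a b : Legs z), a ≠ b →
      |w z {a, b}| ≤ c₀ * Real.exp (-(δ₁ * (HiggsLattice.Site.tdist (pos z a) (pos z b) : ℝ))))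
    (hw0 : ∀ z (B : Finset (Legs z)), B.card ≠ 2 → w z B = 0) :
    |∑ z : Fin n → Col P k qmax Lbl, (∏ j, coef j (z j)) * connSum w z|
      ≤ connConst P.d (Fintype.card Lbl) n qmax c₀ δ₀ δ₁ * A₀ ^ n * Fintype.card (HiggsLattice.Site P k) := by
  set δ' := rate n qmax δ₀ δ₁ with hδ'
  have hδ'pos : 0 < δ' := rate_pos n qmax hδ₀ hδ₁
  set Kb : ℝ := diagBound (n * qmax) * (max 1 c₀) ^ (n * qmax) with hKb
  have hc₁ : 1 ≤ max 1 c₀ := le_max_left _ _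
  have hKb0 : 0 ≤ Kb := mul_nonneg (zero_le_one.trans (one_le_diagBound _)) (pow_nonneg (zero_le_one.trans hc₁) _)
  -- per colouring
  have hz : ∀ z : Fin n → Col P k qmax Lbl,
      |(∏ j, coef j (z j)) * connSum w z| ≤ Kb * A₀ ^ n * Real.exp (-(δ' * (allDiam z : ℝ))) := by
    intro z
    refine (abs_term_le coef w hA₀ hδ₀.le hc₀ hδ₁ hcoef hw2 hw0 z).trans ?_
    have h1 : diagBound (Fintype.card (Legs z)) ≤ diagBound (n * qmax) := diagBound_mono (card_legs_le z)
    have h2 : (max 1 c₀) ^ Fintype.card (Legs z) ≤ (max 1 c₀) ^ (n * qmax) := pow_le_pow_right₀ hc₁ (card_legs_le z)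
    calc diagBound (Fintype.card (Legs z)) * ((max 1 c₀) ^ Fintype.card (Legs z) * A₀ ^ n * Real.exp (-(δ' * (allDiam z : ℝ))))
        ≤ diagBound (n * qmax) * ((max 1 c₀) ^ (n * qmax) * A₀ ^ n * Real.exp (-(δ' * (allDiam z : ℝ)))) :=
          mul_le_mul h1 (mul_le_mul_of_nonneg_right (mul_le_mul_of_nonneg_right h2 (pow_nonneg hA₀ _)) (Real.exp_nonneg _))
            (by positivity) (zero_le_one.trans (one_le_diagBound _))
      _ = Kb * A₀ ^ n * Real.exp (-(δ' * (allDiam z : ℝ))) := by rw [hKb]; ring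
  calc |∑ z : Fin n → Col P k qmax Lbl, (∏ j, coef j (z j)) * connSum w z|
      ≤ ∑ z : Fin n → Col P k qmax Lbl, |(∏ j, coef j (z j)) * connSum w z| := abs_sum_le_sum_abs _ _
    _ ≤ ∑ z : Fin n → Col P k qmax Lbl, Kb * A₀ ^ n * Real.exp (-(δ' * (allDiam z : ℝ))) := sum_le_sum fun z _ => hz z
    _ = Kb * A₀ ^ n * ∑ z : Fin n → Col P k qmax Lbl, Real.exp (-(δ' * (allDiam z : ℝ))) := by rw [mul_sum]
    _ ≤ Kb * A₀ ^ n * ((Fintype.card (HiggsLattice.Site P k) : ℝ) *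
          ∑ qv : Fin n → Fin (qmax + 1), (Fintype.card Lbl : ℝ) ^ (∑ j, (qv j : ℕ)) * treeConst P.d δ' (∑ j, (qv j : ℕ))) :=
        mul_le_mul_of_nonneg_left (sum_exp_neg_allDiam_le hδ'pos) (mul_nonneg hKb0 (pow_nonneg hA₀ _))
    _ = connConst P.d (Fintype.card Lbl) n qmax c₀ δ₀ δ₁ * A₀ ^ n * Fintype.card (HiggsLattice.Site P k) := by
        rw [connConst, hKb, hδ']
        ring

/-- **THE SAME WITH THE SCALE POWER DISPLAYED** (print: the coefficients of `V` carry positive powers of `ε`, (3.58): `O(1)(L^kε)^{κ₀}`; *"Hence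
⟨Vⁿ⟩^T = O(ε^κ)|T₁| with κ > d for n sufficiently large"*): if `|a_j(q;z;κ)| ≦ C₀·s^{κ₀}·e^{−δ₀·diam z}` (`s = L^kε = P.mesh k`, `C₀ ≧ 0`,
`s ≧ 0`), the connected-graph sum is `≦ connConst·C₀ⁿ·s^{κ₀·n}·|T^{(k)}|` — the power `κ = nκ₀` exceeds `d` once `n > d/κ₀`.
[cite: Balaban1982Higgs1, (3.23) p.616; Prop. 3.2 (3.58) p.622] -/
theorem abs_connectedSum_le_scale [Fintype Lbl] {C₀ s κ₀ : ℝ} (hC₀ : 0 ≤ C₀) (hs : 0 ≤ s) (hδ₀ : 0 < δ₀) (hc₀ : 0 ≤ c₀) (hδ₁ : 0 < δ₁)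
    (hcoef : ∀ j c, |coef j c| ≤ C₀ * s ^ κ₀ * Real.exp (-(δ₀ * (diam c.2.1 : ℝ))))
    (hw2 : ∀ z (a b : Legs z), a ≠ b →
      |w z {a, b}| ≤ c₀ * Real.exp (-(δ₁ * (HiggsLattice.Site.tdist (pos z a) (pos z b) : ℝ))))
    (hw0 : ∀ z (B : Finset (Legs z)), B.card ≠ 2 → w z B = 0) :
    |∑ z : Fin n → Col P k qmax Lbl, (∏ j, coef j (z j)) * connSum w z|
      ≤ connConst P.d (Fintype.card Lbl) n qmax c₀ δ₀ δ₁ * C₀ ^ n * s ^ (κ₀ * n) * Fintype.card (HiggsLattice.Site P k) := by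
  have h := abs_connectedSum_le coef w (mul_nonneg hC₀ (Real.rpow_nonneg hs κ₀)) hδ₀ hc₀ hδ₁ hcoef hw2 hw0
  rw [mul_pow, ← Real.rpow_mul_natCast hs] at h
  calc _ ≤ _ := h
    _ = _ := by ring

end Main

/-! ## §6 Plugged into the Gaussian perturbation engine: `|⟨X_1;…;X_n⟩^T| ≦ connConst·A₀ⁿ·|T^{(k)}|` -/

section Gaussian

open Literature.Probability.LatticeModels (ursellOf)
open B3GaussianPerturbationGraphs (jmoment clusterVar pairW legVec ursellOf_jmoment_univ pairW_pair pairW_of_card_ne_two gexp_two_legs)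
open Literature.MathematicalPhysics.QuantumFieldTheory.BalabanImbrieJaffe1984to88.BIJ88TruncationConnected306 (gexp)

variable {P : HiggsLattice.Params} {k : ℕ} {Lbl : Type} {n qmax : ℕ}
variable {S : Type} [Fintype S] [DecidableEq S]

/-- The degree of a monomial index of (3.57). [cite: Balaban1982Higgs1, Prop. 3.2 (3.57) p.622] -/
abbrev cdeg (c : Col P k qmax Lbl) : ℕ := (c.1 : ℕ)

variable (A : Matrix S S ℝ) (coef : Fin n → Col P k qmax Lbl → ℝ) (lv : Col P k qmax Lbl → ℕ → S → ℝ) {A₀ δ₀ c₀ δ₁ : ℝ}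

/-- **`|⟨X_1;…;X_n⟩^T| ≦ connConst·A₀ⁿ·|T^{(k)}|` FOR `n` POLYNOMIAL CLUSTERS OF THE SHAPE (3.57) UNDER A CENTRED GAUSSIAN** (p. 616: *"⟨Vⁿ⟩^T is the
expression corresponding to the sum of connected graphs with exponentially decaying propagators. Hence ⟨Vⁿ⟩^T = O(ε^κ)|T₁|"*): the Ursell
function of the moments `Q ↦ ⟨Π_{j∈Q} X_j⟩` (`X_j = Σ_c a_j(c)Π_i⟨Φ,v_{c,i}⟩`, p33's `jmoment` with every colour allowed) in p13's Gaussian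
`gexp A 0` (`A` positive definite, `n ≧ 1`), under (3.58) in the diameter currency and exponentially decaying propagators.
[cite: Balaban1982Higgs1, (3.23) p.616] -/
theorem abs_ursellOf_jmoment_le [Fintype Lbl] [NeZero n] (hA : A.PosDef) (hA₀ : 0 ≤ A₀) (hδ₀ : 0 < δ₀) (hc₀ : 0 ≤ c₀) (hδ₁ : 0 < δ₁)
    (hcoef : ∀ j c, |coef j c| ≤ A₀ * Real.exp (-(δ₀ * (diam c.2.1 : ℝ))))
    (hprop : ∀ (c c' : Col P k qmax Lbl) (i : Fin (c.1 : ℕ)) (i' : Fin (c'.1 : ℕ)),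
      |gexp A 0 (fun φ => (φ ⬝ᵥ lv c i) * (φ ⬝ᵥ lv c' i'))|
        ≤ c₀ * Real.exp (-(δ₁ * (HiggsLattice.Site.tdist (c.2.1 i) (c'.2.1 i') : ℝ)))) :
    |ursellOf (jmoment A (fun _ : Fin n => (univ : Finset (Col P k qmax Lbl))) coef cdeg lv) univ|
      ≤ connConst P.d (Fintype.card Lbl) n qmax c₀ δ₀ δ₁ * A₀ ^ n * Fintype.card (HiggsLattice.Site P k) := by
  classical
  -- a default colouring (degree 0) for the engine's colour bookkeeping
  let z₀ : Fin n → Col P k qmax Lbl := fun _ => ⟨0, (fun i => i.elim0, fun i => i.elim0)⟩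
  rw [ursellOf_jmoment_univ hA z₀, Fintype.piFinset_univ]
  -- the engine's connected sum IS §3's `connSum` with the Wick pair weights (same legs, same vertex family): definitional
  have hw2 : ∀ (z : Fin n → Col P k qmax Lbl) (a b : Legs z), a ≠ b →
      |pairW A (legVec cdeg lv z) {a, b}| ≤ c₀ * Real.exp (-(δ₁ * (HiggsLattice.Site.tdist (pos z a) (pos z b) : ℝ))) := by
    intro z a b hab
    rw [pairW_pair hA _ hab]
    have h := hprop (z a.1) (z b.1) a.2 b.2
    rw [gexp_two_legs hA] at h
    exact h
  have hw0 : ∀ (z : Fin n → Col P k qmax Lbl) (B : Finset (Legs z)), B.card ≠ 2 → pairW A (legVec cdeg lv z) B = 0 :=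
    fun z B hB => pairW_of_card_ne_two _ hB
  exact abs_connectedSum_le coef (fun z B => pairW A (legVec cdeg lv z) B) hA₀ hδ₀ hc₀ hδ₁ hcoef hw2 hw0

/-- **THE SAME WITH THE SCALE POWER DISPLAYED**: `|a_j(c)| ≦ C₀·s^{κ₀}·e^{−δ₀·diam z_c}` (`s = L^kε`) gives
`|⟨X_1;…;X_n⟩^T| ≦ connConst·C₀ⁿ·s^{κ₀n}·|T^{(k)}|` — *"Hence ⟨Vⁿ⟩^T = O(ε^κ)|T₁| with κ > d for n sufficiently large"* (`κ = nκ₀`).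
[cite: Balaban1982Higgs1, (3.23) p.616; Prop. 3.2 (3.58) p.622] -/
theorem abs_ursellOf_jmoment_le_scale [Fintype Lbl] [NeZero n] (hA : A.PosDef) {C₀ s κ₀ : ℝ} (hC₀ : 0 ≤ C₀) (hs : 0 ≤ s)
    (hδ₀ : 0 < δ₀) (hc₀ : 0 ≤ c₀) (hδ₁ : 0 < δ₁)
    (hcoef : ∀ j c, |coef j c| ≤ C₀ * s ^ κ₀ * Real.exp (-(δ₀ * (diam c.2.1 : ℝ))))
    (hprop : ∀ (c c' : Col P k qmax Lbl) (i : Fin (c.1 : ℕ)) (i' : Fin (c'.1 : ℕ)),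
      |gexp A 0 (fun φ => (φ ⬝ᵥ lv c i) * (φ ⬝ᵥ lv c' i'))|
        ≤ c₀ * Real.exp (-(δ₁ * (HiggsLattice.Site.tdist (c.2.1 i) (c'.2.1 i') : ℝ)))) :
    |ursellOf (jmoment A (fun _ : Fin n => (univ : Finset (Col P k qmax Lbl))) coef cdeg lv) univ|
      ≤ connConst P.d (Fintype.card Lbl) n qmax c₀ δ₀ δ₁ * C₀ ^ n * s ^ (κ₀ * n) * Fintype.card (HiggsLattice.Site P k) := by
  have h := abs_ursellOf_jmoment_le A coef lv hA (mul_nonneg hC₀ (Real.rpow_nonneg hs κ₀)) hδ₀ hc₀ hδ₁ hcoef hprop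
  rw [mul_pow, ← Real.rpow_mul_natCast hs] at h
  calc _ ≤ _ := h
    _ = _ := by ring

end Gaussian

end Literature.MathematicalPhysics.QuantumFieldTheory.Balaban1983to89.B1Eq323ConnectedGraphBound
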